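import Mathlib
import Summits.ValiantsHypothesis.ValiantsHypothesis.Theorems.NewtonTauWeak.Negative.Zonogon
import Summits.ValiantsHypothesis.ValiantsHypothesis.Theorems.NewtonUnitEquationsNewtonTauWeakSeparatedRank
import Summits.ValiantsHypothesis.ValiantsHypothesis.Theorems.NewtonUnitEquationsNewtonTauWeakVdpDefs
import Summits.ValiantsHypothesis.ValiantsHypothesis.Theorems.NewtonUnitEquationsNewtonTauWeakStubVertexCharts
import Summits.ValiantsHypothesis.ValiantsHypothesis.Theorems.NewtonUnitEquationsNewtonTauWeakStubChartPairCount
import Summits.ValiantsHypothesis.ValiantsHypothesis.Theorems.NewtonUnitEquationsNewtonTauWeakStubProductVertices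
import Summits.ValiantsHypothesis.ValiantsHypothesis.Theorems.NewtonUnitEquationsNewtonTauWeakHexagonDelta
import Summits.ValiantsHypothesis.ValiantsHypothesis.Theorems.NewtonUnitEquationsNewtonTauWeakHexagonSeparated

/-!
# `NewtonUnitEquationsNewtonTauWeakHexagonWronskianStructure` — Δ-Wronskian rung, HexagonWronskianStructure

Rung toward `stub_binomialNewtonTauCommon` (crux `NewtonTauWeak`, stmt-ValiantsHypothesis-5904), line
`binomial-normal-form`, lead c3: the GLOBAL Δ-WRONSKIAN argument for sums of three hexagon products
`A(x)·B(y)·C(xy)` (exponent lists on the three lines through `(1,0)`, `(0,1)`, `(1,1)`; any degrees).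

This file: the Wronskian minors of hexagon products `g = X·Y·D` (`X` x-only, `Y` y-only, `D` diagonal) are (diagonal) × (separated of bounded rank): `g₁Δg₂ - g₂Δg₁ ∈ D₁D₂·Sep 4` (registered stub `hex_structure_M2`), `g₁Δ²g₂ - g₂Δ²g₁ ∈ D₁D₂·Sep 8`, `Δg₁Δ²g₂ - Δg₂Δ²g₁ ∈ D₁D₂·Sep 16`, and the `3 × 3` Wronskian `∈ D₀D₁D₂·Sep 48` (registered stub `hex_structure_W3`).

Conventions (spelled inline, no new definitions): `Δ` is ANY self-map of `ℂ[X,Y]` with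
`coeff e (Δ p) = (e₀ - e₁) · coeff e p` (the Euler derivation `X∂_X - Y∂_Y`, which kills the diagonal
direction); "x-only" `P` means `∀ e ∈ P.support, e 1 = 0`, "y-only" `∀ e ∈ Q.support, e 0 = 0`, "diagonal"
`∀ e ∈ D.support, e 0 = e 1`; "separated of rank `R`" means `m = Σ_{r<R} P_r · Q_r` with `P_r` x-only and
`Q_r` y-only. [folklore]
-/

set_option linter.dupNamespace false

noncomputable section

namespace Summit.ValiantsHypothesis.ValiantsHypothesis.Theorems.NewtonUnitEquationsNewtonTauWeak

open scoped BigOperators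
open MvPolynomial
open Literature.Computability.AlgebraicComplexity (newtonVertexCount)
open Summit.ValiantsHypothesis.ValiantsHypothesis.Theorems.NewtonTauWeakVdp
open Summit.ValiantsHypothesis.ValiantsHypothesis.Theorems.NewtonTauWeak.Negative (vert)

namespace HexagonWronskianStructureAux

/-- Transport "separated of rank `R`" along an equality of ranks `R = S` (used to turn the rank
arithmetic `1 * (2 * 1) + 1 * (2 * 1)` produced by the closure lemmas into the literal `4`, etc.). -/
theorem sep_cast {R S : ℕ} {m : MvPolynomial (Fin 2) ℂ}
    (hm : ∃ P Q : Fin R → MvPolynomial (Fin 2) ℂ, (∀ r, ∀ e ∈ (P r).support, e 1 = 0) ∧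
      (∀ r, ∀ e ∈ (Q r).support, e 0 = 0) ∧ m = ∑ r, P r * Q r) (h : R = S) :
    ∃ P Q : Fin S → MvPolynomial (Fin 2) ℂ, (∀ r, ∀ e ∈ (P r).support, e 1 = 0) ∧
      (∀ r, ∀ e ∈ (Q r).support, e 0 = 0) ∧ m = ∑ r, P r * Q r := by
  subst h
  exact hm

/-- A single product `X * Y` (`X` x-only, `Y` y-only) is separated of rank `1`. -/
theorem sep_one (X Y : MvPolynomial (Fin 2) ℂ) (hX : ∀ e ∈ X.support, e 1 = 0)
    (hY : ∀ e ∈ Y.support, e 0 = 0) :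
    ∃ P Q : Fin 1 → MvPolynomial (Fin 2) ℂ, (∀ r, ∀ e ∈ (P r).support, e 1 = 0) ∧
      (∀ r, ∀ e ∈ (Q r).support, e 0 = 0) ∧ X * Y = ∑ r, P r * Q r :=
  ⟨fun _ => X, fun _ => Y, fun _ => hX, fun _ => hY, by rw [Fin.sum_univ_one]⟩

/-- A diagonal factor passes through `Δ` untouched: `Δ (p * D) = Δ p * D` (Leibniz and `Δ D = 0`). -/
theorem delta_mul_diag (Δ : MvPolynomial (Fin 2) ℂ → MvPolynomial (Fin 2) ℂ)
    (hΔ : ∀ p e, coeff e (Δ p) = (((e 0 : ℕ) : ℂ) - ((e 1 : ℕ) : ℂ)) * coeff e p)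
    (hL : ∀ p q, Δ (p * q) = Δ p * q + p * Δ q)
    (D : MvPolynomial (Fin 2) ℂ) (hD : ∀ e ∈ D.support, e 0 = e 1) (p : MvPolynomial (Fin 2) ℂ) :
    Δ (p * D) = Δ p * D := by
  rw [hL, hex_delta_eq_zero_of_diag Δ hΔ D hD, mul_zero, add_zero]

end HexagonWronskianStructureAux

open HexagonWronskianStructureAux in
/-- `M₂ = g₁ Δg₂ - g₂ Δg₁ ∈ (D₁D₂) · Sep 4`. -/
theorem hex_structure_M2 (Δ : MvPolynomial (Fin 2) ℂ → MvPolynomial (Fin 2) ℂ)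
    (hΔ : ∀ p e, coeff e (Δ p) = (((e 0 : ℕ) : ℂ) - ((e 1 : ℕ) : ℂ)) * coeff e p)
    (hL : ∀ p q, Δ (p * q) = Δ p * q + p * Δ q)
    (X₁ Y₁ D₁ X₂ Y₂ D₂ : MvPolynomial (Fin 2) ℂ)
    (hX₁ : ∀ e ∈ X₁.support, e 1 = 0) (hY₁ : ∀ e ∈ Y₁.support, e 0 = 0) (hD₁ : ∀ e ∈ D₁.support, e 0 = e 1)
    (hX₂ : ∀ e ∈ X₂.support, e 1 = 0) (hY₂ : ∀ e ∈ Y₂.support, e 0 = 0) (hD₂ : ∀ e ∈ D₂.support, e 0 = e 1) :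
    ∃ m : MvPolynomial (Fin 2) ℂ,
      (∃ P Q : Fin 4 → MvPolynomial (Fin 2) ℂ, (∀ r, ∀ e ∈ (P r).support, e 1 = 0) ∧
        (∀ r, ∀ e ∈ (Q r).support, e 0 = 0) ∧ m = ∑ r, P r * Q r) ∧
      (X₁ * Y₁ * D₁) * Δ (X₂ * Y₂ * D₂) - (X₂ * Y₂ * D₂) * Δ (X₁ * Y₁ * D₁) = (D₁ * D₂) * m := by
  have hd₁ := delta_mul_diag Δ hΔ hL D₁ hD₁
  have hd₂ := delta_mul_diag Δ hΔ hL D₂ hD₂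
  have h₁ := sep_one X₁ Y₁ hX₁ hY₁
  have h₂ := sep_one X₂ Y₂ hX₂ hY₂
  refine ⟨_, sep_cast (hex_sep_add (hex_sep_mul h₁ (hex_sep_delta Δ hΔ hL h₂))
    (hex_sep_neg (hex_sep_mul h₂ (hex_sep_delta Δ hΔ hL h₁)))) rfl, ?_⟩
  simp only [hd₁, hd₂]
  ring

open HexagonWronskianStructureAux in
/-- `M₁ = g₁ Δ²g₂ - g₂ Δ²g₁ ∈ (D₁D₂) · Sep 8`. -/
theorem hex_structure_M1 (Δ : MvPolynomial (Fin 2) ℂ → MvPolynomial (Fin 2) ℂ)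
    (hΔ : ∀ p e, coeff e (Δ p) = (((e 0 : ℕ) : ℂ) - ((e 1 : ℕ) : ℂ)) * coeff e p)
    (hL : ∀ p q, Δ (p * q) = Δ p * q + p * Δ q)
    (X₁ Y₁ D₁ X₂ Y₂ D₂ : MvPolynomial (Fin 2) ℂ)
    (hX₁ : ∀ e ∈ X₁.support, e 1 = 0) (hY₁ : ∀ e ∈ Y₁.support, e 0 = 0) (hD₁ : ∀ e ∈ D₁.support, e 0 = e 1)
    (hX₂ : ∀ e ∈ X₂.support, e 1 = 0) (hY₂ : ∀ e ∈ Y₂.support, e 0 = 0) (hD₂ : ∀ e ∈ D₂.support, e 0 = e 1) :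
    ∃ m : MvPolynomial (Fin 2) ℂ,
      (∃ P Q : Fin 8 → MvPolynomial (Fin 2) ℂ, (∀ r, ∀ e ∈ (P r).support, e 1 = 0) ∧
        (∀ r, ∀ e ∈ (Q r).support, e 0 = 0) ∧ m = ∑ r, P r * Q r) ∧
      (X₁ * Y₁ * D₁) * Δ (Δ (X₂ * Y₂ * D₂)) - (X₂ * Y₂ * D₂) * Δ (Δ (X₁ * Y₁ * D₁)) = (D₁ * D₂) * m := by
  have hd₁ := delta_mul_diag Δ hΔ hL D₁ hD₁
  have hd₂ := delta_mul_diag Δ hΔ hL D₂ hD₂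
  have h₁ := sep_one X₁ Y₁ hX₁ hY₁
  have h₂ := sep_one X₂ Y₂ hX₂ hY₂
  refine ⟨_, sep_cast (hex_sep_add
    (hex_sep_mul h₁ (hex_sep_delta Δ hΔ hL (hex_sep_delta Δ hΔ hL h₂)))
    (hex_sep_neg (hex_sep_mul h₂ (hex_sep_delta Δ hΔ hL (hex_sep_delta Δ hΔ hL h₁))))) rfl, ?_⟩
  simp only [hd₁, hd₂]
  ring

open HexagonWronskianStructureAux in
/-- `M₀ = Δg₁ Δ²g₂ - Δg₂ Δ²g₁ ∈ (D₁D₂) · Sep 16`. -/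
theorem hex_structure_M0 (Δ : MvPolynomial (Fin 2) ℂ → MvPolynomial (Fin 2) ℂ)
    (hΔ : ∀ p e, coeff e (Δ p) = (((e 0 : ℕ) : ℂ) - ((e 1 : ℕ) : ℂ)) * coeff e p)
    (hL : ∀ p q, Δ (p * q) = Δ p * q + p * Δ q)
    (X₁ Y₁ D₁ X₂ Y₂ D₂ : MvPolynomial (Fin 2) ℂ)
    (hX₁ : ∀ e ∈ X₁.support, e 1 = 0) (hY₁ : ∀ e ∈ Y₁.support, e 0 = 0) (hD₁ : ∀ e ∈ D₁.support, e 0 = e 1)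
    (hX₂ : ∀ e ∈ X₂.support, e 1 = 0) (hY₂ : ∀ e ∈ Y₂.support, e 0 = 0) (hD₂ : ∀ e ∈ D₂.support, e 0 = e 1) :
    ∃ m : MvPolynomial (Fin 2) ℂ,
      (∃ P Q : Fin 16 → MvPolynomial (Fin 2) ℂ, (∀ r, ∀ e ∈ (P r).support, e 1 = 0) ∧
        (∀ r, ∀ e ∈ (Q r).support, e 0 = 0) ∧ m = ∑ r, P r * Q r) ∧
      Δ (X₁ * Y₁ * D₁) * Δ (Δ (X₂ * Y₂ * D₂)) - Δ (X₂ * Y₂ * D₂) * Δ (Δ (X₁ * Y₁ * D₁)) =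
        (D₁ * D₂) * m := by
  have hd₁ := delta_mul_diag Δ hΔ hL D₁ hD₁
  have hd₂ := delta_mul_diag Δ hΔ hL D₂ hD₂
  have h₁ := sep_one X₁ Y₁ hX₁ hY₁
  have h₂ := sep_one X₂ Y₂ hX₂ hY₂
  refine ⟨_, sep_cast (hex_sep_add
    (hex_sep_mul (hex_sep_delta Δ hΔ hL h₁) (hex_sep_delta Δ hΔ hL (hex_sep_delta Δ hΔ hL h₂)))
    (hex_sep_neg (hex_sep_mul (hex_sep_delta Δ hΔ hL h₂)
      (hex_sep_delta Δ hΔ hL (hex_sep_delta Δ hΔ hL h₁))))) rfl, ?_⟩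
  simp only [hd₁, hd₂]
  ring

open HexagonWronskianStructureAux in
/-- The `3 × 3` Wronskian (cofactor expansion along the first column) `∈ (D₀D₁D₂) · Sep 48`. -/
theorem hex_structure_W3 (Δ : MvPolynomial (Fin 2) ℂ → MvPolynomial (Fin 2) ℂ)
    (hΔ : ∀ p e, coeff e (Δ p) = (((e 0 : ℕ) : ℂ) - ((e 1 : ℕ) : ℂ)) * coeff e p)
    (hL : ∀ p q, Δ (p * q) = Δ p * q + p * Δ q)
    (X₀ Y₀ D₀ X₁ Y₁ D₁ X₂ Y₂ D₂ : MvPolynomial (Fin 2) ℂ)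
    (hX₀ : ∀ e ∈ X₀.support, e 1 = 0) (hY₀ : ∀ e ∈ Y₀.support, e 0 = 0) (hD₀ : ∀ e ∈ D₀.support, e 0 = e 1)
    (hX₁ : ∀ e ∈ X₁.support, e 1 = 0) (hY₁ : ∀ e ∈ Y₁.support, e 0 = 0) (hD₁ : ∀ e ∈ D₁.support, e 0 = e 1)
    (hX₂ : ∀ e ∈ X₂.support, e 1 = 0) (hY₂ : ∀ e ∈ Y₂.support, e 0 = 0) (hD₂ : ∀ e ∈ D₂.support, e 0 = e 1) :
    ∃ m : MvPolynomial (Fin 2) ℂ,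
      (∃ P Q : Fin 48 → MvPolynomial (Fin 2) ℂ, (∀ r, ∀ e ∈ (P r).support, e 1 = 0) ∧
        (∀ r, ∀ e ∈ (Q r).support, e 0 = 0) ∧ m = ∑ r, P r * Q r) ∧
      (X₀ * Y₀ * D₀) * (Δ (X₁ * Y₁ * D₁) * Δ (Δ (X₂ * Y₂ * D₂)) - Δ (X₂ * Y₂ * D₂) * Δ (Δ (X₁ * Y₁ * D₁)))
        - Δ (X₀ * Y₀ * D₀) * ((X₁ * Y₁ * D₁) * Δ (Δ (X₂ * Y₂ * D₂)) - (X₂ * Y₂ * D₂) * Δ (Δ (X₁ * Y₁ * D₁)))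
        + Δ (Δ (X₀ * Y₀ * D₀)) * ((X₁ * Y₁ * D₁) * Δ (X₂ * Y₂ * D₂) - (X₂ * Y₂ * D₂) * Δ (X₁ * Y₁ * D₁))
        = (D₀ * D₁ * D₂) * m := by
  obtain ⟨m₀, hm₀, e₀⟩ := hex_structure_M0 Δ hΔ hL X₁ Y₁ D₁ X₂ Y₂ D₂ hX₁ hY₁ hD₁ hX₂ hY₂ hD₂
  obtain ⟨m₁, hm₁, e₁⟩ := hex_structure_M1 Δ hΔ hL X₁ Y₁ D₁ X₂ Y₂ D₂ hX₁ hY₁ hD₁ hX₂ hY₂ hD₂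
  obtain ⟨m₂, hm₂, e₂⟩ := hex_structure_M2 Δ hΔ hL X₁ Y₁ D₁ X₂ Y₂ D₂ hX₁ hY₁ hD₁ hX₂ hY₂ hD₂
  rw [e₀, e₁, e₂]
  have hd₀ := delta_mul_diag Δ hΔ hL D₀ hD₀
  have h₀ := sep_one X₀ Y₀ hX₀ hY₀
  refine ⟨_, sep_cast (hex_sep_add (hex_sep_add (hex_sep_mul h₀ hm₀)
    (hex_sep_neg (hex_sep_mul (hex_sep_delta Δ hΔ hL h₀) hm₁)))
    (hex_sep_mul (hex_sep_delta Δ hΔ hL (hex_sep_delta Δ hΔ hL h₀)) hm₂)) rfl, ?_⟩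
  simp only [hd₀]
  ring


end Summit.ValiantsHypothesis.ValiantsHypothesis.Theorems.NewtonUnitEquationsNewtonTauWeak

end
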